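import Summits.Ventures.PercRepro.S2NineCaps

/-!
# PercRepro — S2: THE CIRCUIT CAPS AT CORANK `15` — THE CELLS `(13, 15)`, `(12, 15)` AND `(11, 15)` (p7, gen 19; sub-claim S2; the row `p = 13`)

The caps the cells of corank `15` feed to the kit: on the coloop-free `e`-free core of rank `13` on `28` points `s₃ ≤ 47` (`TriangleCap.cq3 15`),
`s₄ ≤ 618 = ⌊28·530/24⌋` (the averaging recursion on `avgChain16 14 = 530`), `s₅ ≤ 7154 = ⌊28·5877/23⌋`
(on `avgChain5b 14 = 5877`) — **`caps_thirteen_fifteen_cf`**; on the scaled coloop-free cell `(12, 15)` (`27` points) `47 / 622 / 7212` —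
**`caps_twelve_fifteen_cf`**; on the twice-scaled cell `(11, 15)` (`26` points, coloops allowed) the plain nullity-`15` caps `47 / 662 / 7836`
(`avgChain16 15`, `avgChain5b 15`) — **`caps_eleven_fifteen`**. Nothing about any cell is claimed. Axioms: standard.
-/

open scoped Matroid

namespace PercRepro

namespace ThmN

open Set

variable {α : Type}

/-- The coloop-free caps at `(13, 15)`: `s₃ ≤ 47`, `s₄ ≤ 618` (`⌊28·530/24⌋` on `avgChain16 14`), `s₅ ≤ 7154` (`⌊28·5877/23⌋`). -/
theorem caps_thirteen_fifteen_cf (M : Matroid α) [M.Finite]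
    (hd : M.E.encard = M.eRank + ((15 : ℕ) : ℕ∞)) (hn : M.E.ncard = 13 + 15)
    (hfree : ∀ e ∈ M.E, ∃ A ⊆ M.E \ {e}, e ∉ M.closure A ∧ e ∉ M.closure ((M.E \ {e}) \ A)) (hK : ∀ e, ¬ M.IsColoop e) :
    {C : Set α | M.IsCircuit C ∧ C.ncard = 3}.ncard ≤ 47 ∧
      {C : Set α | M.IsCircuit C ∧ C.ncard = 4}.ncard ≤ 618 ∧
        {C : Set α | M.IsCircuit C ∧ C.ncard = 5}.ncard ≤ 7154 := by
  have hs3 := TriangleCap.core_ncard_triangles_le_cq3 M hfree hd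
  rw [show TriangleCap.cq3 15 = 47 by decide] at hs3
  have hcol : M.coloops = ∅ := S2.coloops_eq_empty_of_forall_not M hK
  have hm : 28 ≤ (M.E \ M.coloops).ncard := by
    rw [hcol, Set.sdiff_empty, hn]
  have hd' : M.E.encard = M.eRank + (((14 : ℕ) : ℕ∞) + 1) := by
    rw [hd]; norm_num
  have h := S1.ncard_fourCircuits_sub_div_le_of_nonColoops M hfree hd' (by norm_num) hm (B := 530)
    (fun M' _ hfree' hd'' => by
      have h := ncard_fourCircuits_le_avgChain16 14 M' hfree' hd''
      rw [show avgChain16 14 = 530 by decide] at h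
      exact h)
  have hs4 : {C : Set α | M.IsCircuit C ∧ C.ncard = 4}.ncard ≤ 618 := by
    have := S1.le_mul_div_of_sub_div_le (by norm_num : 4 < 28) h
    omega
  have hs5 := S2.ncard_fiveCircuits_le_of_no_coloop M hfree hd' hK (by omega)
  rw [hn] at hs5
  have h5 : (13 + 15) * S1.avgChain5b 14 / (13 + 15 - 5) = 7154 := by
    rw [show S1.avgChain5b 14 = 5877 by decide]
  rw [h5] at hs5
  exact ⟨hs3, hs4, hs5⟩

/-- The coloop-free caps at `(12, 15)`: `s₃ ≤ 47`, `s₄ ≤ 622` (`⌊27·530/23⌋` on `avgChain16 14`), `s₅ ≤ 7212` (`⌊27·5877/22⌋`). -/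
theorem caps_twelve_fifteen_cf (M : Matroid α) [M.Finite]
    (hd : M.E.encard = M.eRank + ((15 : ℕ) : ℕ∞)) (hn : M.E.ncard = 12 + 15)
    (hfree : ∀ e ∈ M.E, ∃ A ⊆ M.E \ {e}, e ∉ M.closure A ∧ e ∉ M.closure ((M.E \ {e}) \ A)) (hK : ∀ e, ¬ M.IsColoop e) :
    {C : Set α | M.IsCircuit C ∧ C.ncard = 3}.ncard ≤ 47 ∧
      {C : Set α | M.IsCircuit C ∧ C.ncard = 4}.ncard ≤ 622 ∧
        {C : Set α | M.IsCircuit C ∧ C.ncard = 5}.ncard ≤ 7212 := by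
  have hs3 := TriangleCap.core_ncard_triangles_le_cq3 M hfree hd
  rw [show TriangleCap.cq3 15 = 47 by decide] at hs3
  have hcol : M.coloops = ∅ := S2.coloops_eq_empty_of_forall_not M hK
  have hm : 27 ≤ (M.E \ M.coloops).ncard := by
    rw [hcol, Set.sdiff_empty, hn]
  have hd' : M.E.encard = M.eRank + (((14 : ℕ) : ℕ∞) + 1) := by
    rw [hd]; norm_num
  have h := S1.ncard_fourCircuits_sub_div_le_of_nonColoops M hfree hd' (by norm_num) hm (B := 530)
    (fun M' _ hfree' hd'' => by
      have h := ncard_fourCircuits_le_avgChain16 14 M' hfree' hd''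
      rw [show avgChain16 14 = 530 by decide] at h
      exact h)
  have hs4 : {C : Set α | M.IsCircuit C ∧ C.ncard = 4}.ncard ≤ 622 := by
    have := S1.le_mul_div_of_sub_div_le (by norm_num : 4 < 27) h
    omega
  have hs5 := S2.ncard_fiveCircuits_le_of_no_coloop M hfree hd' hK (by omega)
  rw [hn] at hs5
  have h5 : (12 + 15) * S1.avgChain5b 14 / (12 + 15 - 5) = 7212 := by
    rw [show S1.avgChain5b 14 = 5877 by decide]
  rw [h5] at hs5
  exact ⟨hs3, hs4, hs5⟩

/-- The caps at `(11, 15)` (coloops allowed): `s₃ ≤ 47`, `s₄ ≤ 662 = avgChain16 15`, `s₅ ≤ 7836 = avgChain5b 15`. -/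
theorem caps_eleven_fifteen (M : Matroid α) [M.Finite]
    (hd : M.E.encard = M.eRank + ((15 : ℕ) : ℕ∞))
    (hfree : ∀ e ∈ M.E, ∃ A ⊆ M.E \ {e}, e ∉ M.closure A ∧ e ∉ M.closure ((M.E \ {e}) \ A)) :
    {C : Set α | M.IsCircuit C ∧ C.ncard = 3}.ncard ≤ 47 ∧
      {C : Set α | M.IsCircuit C ∧ C.ncard = 4}.ncard ≤ 662 ∧
        {C : Set α | M.IsCircuit C ∧ C.ncard = 5}.ncard ≤ 7836 := by
  have hs3 := TriangleCap.core_ncard_triangles_le_cq3 M hfree hd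
  rw [show TriangleCap.cq3 15 = 47 by decide] at hs3
  have hs4 := ncard_fourCircuits_le_avgChain16 15 M hfree hd
  rw [show avgChain16 15 = 662 by decide] at hs4
  have hs5 := S1.ncard_fiveCircuits_le_avgChain5b 15 M hfree hd
  rw [show S1.avgChain5b 15 = 7836 by decide] at hs5
  exact ⟨hs3, hs4, hs5⟩

end ThmN

end PercRepro
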